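import Literature.AlgebraicTopology.Homotopy.FreudenthalSubsingleton
import Literature.Topology.FourManifolds.PiStableFourHomotopyGroup
import HarnessLib

/-!
# `Π₄ = 0` is one homotopy group: the named fact `piStable_four_trivial` is `π₁₀(S⁶) = 0`

Topic `Literature/Topology/FourManifolds`. Kervaire–Milnor, *Groups of homotopy spheres I*,
Ann. of Math. 77 (1963), §4, p. 510: "The homotopy class of `p(M, φ)` is a well defined element of
the **stable** homotopy group `Πₙ = πₙ₊ₖ(Sᵏ)`", `k > n + 1` — the independence of `k` being the
Freudenthal suspension theorem (Hatcher, *Algebraic Topology* (2002), Cor. 4.24: `πᵢ(Sⁿ) ≅ πᵢ₊₁(Sⁿ⁺¹)`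
for `i < 2n - 1`). The tree states `Π₄ = 0` as the named fact
`Literature.Topology.FourManifolds.piStable_four_trivial` (every `S⁴⁺ᵏ → ℝᵏ ∪ {∞}`, `k > 5`, is
null-homotopic), equivalently (`PiStableFourHomotopyGroup.lean`) `π₄₊ₖ(Sᵏ) = 0` for **all** `k > 5`.
With the vanishing form of Freudenthal's theorem proved in
`Literature/AlgebraicTopology/Homotopy/FreudenthalSubsingleton.lean` this infinite family collapses to a
single group; this file PROVES:

* `piStable_four_trivial_iff_subsingleton_pi_ten_sphere_six` — `Π₄ = 0 ↔ π₁₀(S⁶) = 0` (at all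
  base points);
* `piStable_four_trivial_iff_subsingleton_pi_of_le` — `Π₄ = 0 ↔ π₄₊ₖ₀(S^{k₀}) = 0` for any one
  `k₀ ≥ 6`.

So a discharge of the named fact now needs exactly one computation, `π₁₀(S⁶) = 0` (Serre 1951–53;
Toda 1962, Ch. V; the value `Π₄ = 0` is the column `n = 4` of the table on p. 512 of
Kervaire–Milnor), and nothing about all `k`. Everything here is proved; no named facts.

## References

* M. Kervaire, J. Milnor, *Groups of homotopy spheres I*, Ann. of Math. (2) 77 (1963), 504–537:
  §4, p. 510 (`Πₙ = πₙ₊ₖ(Sᵏ)` stable, `k > n + 1`), table p. 512 (`Π₄ = 0`). doi:10.2307/1970128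
  [KervaireMilnorAnnals1963]
* A. Hatcher, *Algebraic Topology*, CUP (2002), §4.2, Cor. 4.24 (Freudenthal suspension theorem)
  and the table of `πᵢ(Sⁿ)`, p. 339. [HatcherAT2002]
-/

noncomputable section

namespace Literature.Topology.FourManifolds

open Literature.AlgebraicTopology.Homotopy
open scoped _root_.Topology

/-- Local notation: `𝕊 n` is the unit sphere in `EuclideanSpace ℝ (Fin (n + 1))`. -/
local notation "𝕊 " n:arg => (Metric.sphere (0 : EuclideanSpace ℝ (Fin (n + 1))) 1)

/-- **Upwards stability of `π₄₊ₖ(Sᵏ) = 0` from `k = 6`** (Freudenthal, surjectivity range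
`(4 + k) + 1 ≤ 2k`): if `π₁₀(S⁶) = 0` then `π₄₊ₖ(Sᵏ) = 0` for every `k ≥ 6`, at all base points.
[cite: HatcherAT2002, §4.2 Cor. 4.24; KervaireMilnorAnnals1963, §4 p. 510] -/
theorem subsingleton_pi_four_add_of_six (h6 : ∀ x : 𝕊 6, Subsingleton (π_ 10 (𝕊 6) x)) :
    ∀ k : ℕ, 6 ≤ k → ∀ x : 𝕊 k, Subsingleton (π_ (4 + k) (𝕊 k) x) := by
  intro k hk
  induction k, hk using Nat.le_induction with
  | base => exact h6
  | succ k hk ih =>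
    intro x
    exact Freudenthal.subsingleton_pi_sphere_succ (n := k) (i := 4 + k) (by omega) ih x

/-- **Downwards stability of `π₄₊ₖ(Sᵏ) = 0` to `k = 6`** (Freudenthal, injectivity range
`(4 + k) + 2 ≤ 2k` for `k ≥ 6`): if `π₄₊ₖ₀(S^{k₀}) = 0` for some `k₀ ≥ 6` then `π₁₀(S⁶) = 0`.
[cite: HatcherAT2002, §4.2 Cor. 4.24; KervaireMilnorAnnals1963, §4 p. 510] -/
theorem subsingleton_pi_ten_sphere_six_of {k₀ : ℕ} (hk₀ : 6 ≤ k₀)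
    (h : ∀ x : 𝕊 k₀, Subsingleton (π_ (4 + k₀) (𝕊 k₀) x)) :
    ∀ x : 𝕊 6, Subsingleton (π_ 10 (𝕊 6) x) := by
  -- descend from `6 + m` to `6`
  suffices key : ∀ m : ℕ, (∀ x : 𝕊 (6 + m), Subsingleton (π_ (4 + (6 + m)) (𝕊 (6 + m)) x)) →
      ∀ x : 𝕊 6, Subsingleton (π_ 10 (𝕊 6) x) by
    obtain ⟨m, rfl⟩ := Nat.exists_eq_add_of_le hk₀
    exact key m h
  intro m
  induction m with
  | zero => intro h; exact h
  | succ m ih =>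
    intro h
    refine ih fun x => ?_
    exact Freudenthal.subsingleton_pi_sphere_of_succ (n := 6 + m) (i := 4 + (6 + m)) (by omega) h x

/-- **`Π₄ = 0` is `π₁₀(S⁶) = 0`.** The named fact `piStable_four_trivial` (Kervaire–Milnor 1963,
§4: the stable stem `Π₄ = π₄₊ₖ(Sᵏ)`, `k > 5`, vanishes; every `S⁴⁺ᵏ → ℝᵏ ∪ {∞}` is null-homotopic)
holds iff Mathlib's `π_ 10` of the Euclidean unit `6`-sphere is trivial at every base point: the
`k`-independence is Freudenthal's suspension theorem (Hatcher 2002, Cor. 4.24), proved in the tree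
in vanishing form (`Freudenthal.subsingleton_pi_sphere_succ_iff`).
[cite: KervaireMilnorAnnals1963, §4, p. 510 (Πₙ stable) and table p. 512 (Π₄ = 0); HatcherAT2002, §4.2 Cor. 4.24] -/
theorem piStable_four_trivial_iff_subsingleton_pi_ten_sphere_six :
    piStable_four_trivial ↔ ∀ x : 𝕊 6, Subsingleton (π_ 10 (𝕊 6) x) := by
  rw [piStable_four_trivial_iff_subsingleton_homotopyGroup]
  constructor
  · intro h x
    exact h 6 (by norm_num) x
  · intro h k hk x
    exact subsingleton_pi_four_add_of_six h k (by omega) x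

/-- **`Π₄ = 0` is `π₄₊ₖ₀(S^{k₀}) = 0` for any single `k₀ ≥ 6`** (Kervaire–Milnor 1963, §4, with
Freudenthal's theorem in both directions). [cite: KervaireMilnorAnnals1963, §4, p. 510 and table p. 512; HatcherAT2002, §4.2 Cor. 4.24] -/
theorem piStable_four_trivial_iff_subsingleton_pi_of_le {k₀ : ℕ} (hk₀ : 6 ≤ k₀) :
    piStable_four_trivial ↔ ∀ x : 𝕊 k₀, Subsingleton (π_ (4 + k₀) (𝕊 k₀) x) := by
  constructor
  · intro h
    exact (piStable_four_trivial_iff_subsingleton_homotopyGroup.1 h) k₀ (by omega)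
  · intro h
    exact piStable_four_trivial_iff_subsingleton_pi_ten_sphere_six.2
      (subsingleton_pi_ten_sphere_six_of hk₀ h)

end Literature.Topology.FourManifolds
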